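import Mathlib
import Summits.ResolutionOfSingularities.ResolutionOfSingularities.Theorems.DefectlessFramesDefectlessFramesRTwistDegree
import Summits.ResolutionOfSingularities.ResolutionOfSingularities.Theorems.DefectlessFramesDefectlessFramesRTwistSubst

/-!
# Zariski A.IV / Nagata re-framing of hypersurface frames (stub `stub_dfrTwist`)

Crux `DefectlessFramesR`, line `Sketch`. Given a hypersurface frame `(y; z; f)` of `K/k` at a rank-one
zero-dimensional place `O` (`y` algebraically independent in `O`, `k(y, z) = K`, `(f) = ker (k[X] → K)`,
`f ≠ 0`), we produce the dominating frame `y'_j = y_j + ν(z)^{N_j}`, `z' = z`, `f' = f(X - ν(X_n)^N, X_n)`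
where `ν ∈ k[T]` is monic irreducible with `ν(z)` in the maximal ideal of `O` and the `N_j` are Nagata
exponents `M^{j+1} (+1)` with `M` a large power of `p` (the shift by `1` at one index `j₀ < n` with
`∂f/∂X_{j₀} ≠ 0` is used exactly when `∂f/∂X_n = 0`; some partial derivative of the irreducible `f` is
non-zero because `k` is perfect). Then `k[y', z] = k[y, z]`, `(f') = ker`, `f'` has a unit leading
coefficient in `X_n` (so `z` is integral over `k[y']`, `y'` is algebraically independent and the axis
polynomial `f'(ȳ', X)` is non-zero), the axis order at `z̄` does not increase (the residues of `y'` and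
`y` agree and the perturbation is divisible by `(X - z̄)^{N_j}`), and `∂f'/∂X_n ≠ 0`, which by Gauss's
lemma over the UFD `k[y']` makes `z` separable over `k(y')`.
-/

namespace Summit.ResolutionOfSingularities.ResolutionOfSingularities.Theorems

open MvPolynomial Polynomial

/-- **Zariski A.IV / Nagata re-framing** (stub `stub_dfrTwist` of crux `DefectlessFramesR`, line `Sketch`).
Every hypersurface frame `(y; z; f)` with `f ≠ 0` over a rank-one zero-dimensional place is dominated by an
integral frame `(y'; z; f')` in general position with axis order not increased and `z` separable over
`k(y')`: `y'_j = y_j + ν(z)^{N_j}` with `ν` a monic irreducible polynomial over `k` vanishing at `z` modulo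
the maximal ideal, `N_j` Nagata exponents (powers of `p`, one of them shifted by `1` when `∂f/∂X_n = 0`),
and `f' = f(X - ν(X_n)^N, X_n)`. [folklore] -/
theorem stub_dfrTwist : ∀ p : ℕ, p.Prime → ∀ (k K : Type) [Field k] [CharP k p] [PerfectField k] [Field K] [Algebra k K], (⊤ : IntermediateField k K).FG → ∀ O : ValuationSubring K, ∀ hk : (∀ c : k, algebraMap k K c ∈ O), Nonempty O.valuation.RankOne → (∀ x ∈ O, ∃ f : Polynomial k, f ≠ 0 ∧ Polynomial.aeval x f ∈ O.nonunits) → let ρ : k →+* IsLocalRing.ResidueField O := (IsLocalRing.residue O).comp ((algebraMap k K).codRestrict O hk); let axis : (m : ℕ) → (Fin m → O) → MvPolynomial (Fin (m + 1)) k → Polynomial (IsLocalRing.ResidueField O) := fun _ w g => MvPolynomial.eval₂ (Polynomial.C.comp ρ) (Fin.snoc (fun j => Polynomial.C (IsLocalRing.residue O (w j))) Polynomial.X) g; ∀ (n : ℕ) (y : Fin n → O) (z : O) (f : MvPolynomial (Fin (n + 1)) k), AlgebraicIndependent k (fun i => (y i : K)) → IntermediateField.adjoin k (Set.range (fun i =>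 (y i : K)) ∪ {(z : K)}) = ⊤ → Ideal.span {f} = RingHom.ker (MvPolynomial.aeval (Fin.snoc (fun i => (y i : K)) (z : K)) : MvPolynomial (Fin (n + 1)) k →ₐ[k] K) → f ≠ 0 → ∃ (y' : Fin n → O) (z' : O) (f' : MvPolynomial (Fin (n + 1)) k), AlgebraicIndependent k (fun i => (y' i : K)) ∧ IsIntegral (Algebra.adjoin k (Set.range fun i => (y' i : K))) (z' : K) ∧ IntermediateField.adjoin k (Set.range (fun i => (y' i : K)) ∪ {(z' : K)}) = ⊤ ∧ Ideal.span {f'} = RingHom.ker (MvPolynomial.aeval (Fin.snoc (fun i => (y' i : K)) (z' : K)) : MvPolynomial (Fin (n + 1)) k →ₐ[k] K) ∧ (∀ i, (y i : K) ∈ Algebra.adjoin k (Set.range (fun i => (y' i : K)) ∪ {(z' : K)})) ∧ (z : K) ∈ Algebra.adjoin k (Set.range (fun i => (y' i : K)) ∪ {(z' : K)}) ∧ axis n y' f' ≠ 0 ∧ (axis n y f ≠ 0 → (axis n y' f').rootMultiplicity (IsLocalRing.residue O z') ≤ (axis n y f).rootMultiplicity (IsLocalRing.residue O z)) ∧ IsSeparable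 (IntermediateField.adjoin k (Set.range fun i => (y' i : K))) (z' : K) := by
  intro p hp k K _ _ _ _ _ _hfg O hk _hR hZ ρ axis n y z f hy hadj hker hf
  classical
  -- constants into `O`
  set ι : k →+* O := (algebraMap k K).codRestrict O hk with hι
  have hρ : ρ = (IsLocalRing.residue O).comp ι := rfl
  -- the polynomial `ν`
  obtain ⟨g₀, hg₀, hg₀z⟩ := hZ (z : K) z.2
  have hg₀z' : g₀.eval₂ ι z ∈ IsLocalRing.maximalIdeal O := by
    rw [← dfrTwist_coe_eval₂ O hk z g₀] at hg₀z
    exact ValuationSubring.coe_mem_nonunits_iff.mp hg₀z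
  obtain ⟨ν, hνirr, hνmon, hνz⟩ := dfrTwist_exists_irreducible_eval₂_mem ι z g₀ hg₀ hg₀z'
  have hν1 : 0 < ν.natDegree := Irreducible.natDegree_pos hνirr
  have hν0 : ν ≠ 0 := hνirr.ne_zero
  have hν' : derivative ν ≠ 0 :=
    dfrTwist_derivative_ne_zero_of_separable ν (PerfectField.separable_of_irreducible hνirr) hν1
  set w : O := ν.eval₂ ι z with hw
  have hw0 : IsLocalRing.residue O w = 0 := (IsLocalRing.residue_eq_zero_iff _).mpr hνz
  have hwK : (w : K) = Polynomial.aeval (z : K) ν := dfrTwist_coe_eval₂ O hk z ν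
  -- `f` is irreducible and not constant; some partial derivative of `f` is non-zero
  have hfirr : Irreducible f := by
    have hprime : (Ideal.span {f}).IsPrime := by rw [hker]; exact RingHom.ker_isPrime _
    exact ((Ideal.span_singleton_prime hf).mp hprime).irreducible
  have hfz : MvPolynomial.aeval (Fin.snoc (fun i => (y i : K)) (z : K)) f = 0 := by
    rw [← RingHom.mem_ker, ← hker]; exact Ideal.mem_span_singleton_self f
  obtain ⟨α₁, hα₁, hα₁0⟩ : ∃ α ∈ f.support, α ≠ 0 := by
    by_contra hcon
    push Not at hcon
    have htd : f.totalDegree = 0 :=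
      (MvPolynomial.totalDegree_eq_zero_iff (p := f)).mpr fun m hm x => by rw [hcon m hm]; rfl
    rw [MvPolynomial.totalDegree_eq_zero_iff_eq_C] at htd
    rw [htd, MvPolynomial.algHom_C, map_eq_zero_iff _ (algebraMap k K).injective] at hfz
    exact hf (by rw [htd, hfz, map_zero])
  obtain ⟨i0, hi0⟩ := dfrTwist_exists_pderiv_ne_zero p hp f hfirr
  -- the exponents
  set s : ℕ := (axis n y f).rootMultiplicity (IsLocalRing.residue O z) with hs
  set d : ℕ := f.totalDegree with hd
  obtain ⟨M, hM⟩ : ∃ M : ℕ, M = p ^ (d + s + 1) := ⟨_, rfl⟩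
  have hdM : d < M := hM ▸ lt_of_le_of_lt (by omega) (Nat.lt_pow_self hp.one_lt)
  have hsM : s < M := hM ▸ lt_of_le_of_lt (by omega) (Nat.lt_pow_self hp.one_lt)
  have hM0 : 0 < M := hM ▸ pow_pos hp.pos _
  have hMk : (M : k) = 0 := by
    rw [hM, Nat.cast_pow, CharP.cast_eq_zero k p, zero_pow (by omega)]
  obtain ⟨t, htnone, htsome⟩ : ∃ t : Option (Fin n), (t = none → pderiv (Fin.last n) f ≠ 0) ∧
      (∀ j0, t = some j0 → pderiv (Fin.last n) f = 0 ∧ pderiv (Fin.castSucc j0) f ≠ 0) := by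
    by_cases hlast : pderiv (Fin.last n) f = 0
    · have hne : i0 ≠ Fin.last n := fun h => hi0 (h ▸ hlast)
      obtain ⟨j0, rfl⟩ := Fin.exists_castSucc_eq.mpr hne
      exact ⟨some j0, fun h => (Option.some_ne_none _ h).elim, fun j hj => by
        cases Option.some_injective _ hj
        exact ⟨hlast, hi0⟩⟩
    · exact ⟨none, fun _ => hlast, fun j0 h => (Option.some_ne_none _ h.symm).elim⟩
  obtain ⟨N, hN⟩ : ∃ N : Fin n → ℕ, ∀ j, N j = M ^ ((j : ℕ) + 1) + if t = some j then 1 else 0 :=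
    ⟨_, fun j => rfl⟩
  have hMj : ∀ j : Fin n, M ≤ M ^ ((j : ℕ) + 1) := fun j =>
    calc M = M ^ 1 := (pow_one M).symm
      _ ≤ M ^ ((j : ℕ) + 1) := Nat.pow_le_pow_right hM0 (by omega)
  have hN0 : ∀ j, 0 < N j := fun j => by rw [hN j]; have := hMj j; omega
  have hNs : ∀ j, s + 1 ≤ N j := fun j => by rw [hN j]; have := hMj j; omega
  have hNcast : ∀ j, ((N j : ℕ) : k) = if t = some j then 1 else 0 := fun j => by
    simp only [hN j, Nat.cast_add, Nat.cast_pow, hMk, zero_pow (Nat.succ_ne_zero _), zero_add, Nat.cast_ite,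
      Nat.cast_one, Nat.cast_zero]
  -- the new frame
  set y' : Fin n → O := fun j => y j + w ^ N j with hy'
  have hy'K : ∀ j, (y' j : K) = (y j : K) + (Polynomial.aeval (z : K) ν) ^ N j := fun j => by
    simp only [hy']
    push_cast
    rw [hwK]
  have hyfun : (fun j => (y' j : K)) = fun j => (y j : K) + (Polynomial.aeval (z : K) ν) ^ N j :=
    funext hy'K
  have hres : ∀ j, IsLocalRing.residue O (y' j) = IsLocalRing.residue O (y j) := fun j => by
    simp only [hy', map_add, map_pow, hw0, zero_pow (Nat.pos_iff_ne_zero.mp (hN0 j)), add_zero]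
  set f' : MvPolynomial (Fin (n + 1)) k := MvPolynomial.aeval (Fin.snoc (fun j =>
    (MvPolynomial.X (Fin.castSucc j) : MvPolynomial (Fin (n + 1)) k) +
      (-1 : k) • (Polynomial.aeval (MvPolynomial.X (Fin.last n)) ν) ^ N j) (MvPolynomial.X (Fin.last n))) f
    with hf'
  -- kernel
  have hker' : Ideal.span {f'} = RingHom.ker (MvPolynomial.aeval (Fin.snoc (fun i => (y' i : K)) (z : K)) :
      MvPolynomial (Fin (n + 1)) k →ₐ[k] K) := by
    rw [hyfun]; exact dfrTwist_ker_twist ν N (fun i => (y i : K)) (z : K) f hker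
  have hf'z : MvPolynomial.aeval (Fin.snoc (fun i => (y' i : K)) (z : K)) f' = 0 := by
    rw [← RingHom.mem_ker, ← hker']; exact Ideal.mem_span_singleton_self f'
  -- Nagata: degree and leading coefficient of the twisted polynomial in `A[X]`
  have hdeg_le : ∀ α ∈ f.support, ∑ i, α i ≤ d := fun α hα => by
    have := MvPolynomial.le_totalDegree hα
    rwa [Finsupp.sum_fintype _ _ (fun _ => rfl)] at this
  have hinj : ∀ α ∈ f.support, ∀ β ∈ f.support,
      ν.natDegree * (∑ j : Fin n, N j * α (Fin.castSucc j)) + α (Fin.last n)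
        = ν.natDegree * (∑ j : Fin n, N j * β (Fin.castSucc j)) + β (Fin.last n) → α = β := by
    intro α hα β hβ h
    simp only [hN] at h
    exact dfrTwist_twistedDegree_inj ν.natDegree M d hν1 hdM t α β (hdeg_le α hα) (hdeg_le β hβ) h
  obtain ⟨αm, _hαm, hFdeg, hFunit, hmax⟩ := dfrTwist_leadingCoeff_of_injOn ν hνmon hν1 N hN0 f hf hinj
  -- the twist equivalence; irreducibility; injectivity of the twisted evaluation
  let eT : MvPolynomial (Fin (n + 1)) k ≃ₐ[k] MvPolynomial (Fin (n + 1)) k :=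
    AlgEquiv.ofAlgHom
      (MvPolynomial.aeval (Fin.snoc (fun j => (MvPolynomial.X (Fin.castSucc j) : MvPolynomial (Fin (n + 1)) k) +
        (-1 : k) • (Polynomial.aeval (MvPolynomial.X (Fin.last n)) ν) ^ N j) (MvPolynomial.X (Fin.last n))))
      (MvPolynomial.aeval (Fin.snoc (fun j => (MvPolynomial.X (Fin.castSucc j) : MvPolynomial (Fin (n + 1)) k) +
        (1 : k) • (Polynomial.aeval (MvPolynomial.X (Fin.last n)) ν) ^ N j) (MvPolynomial.X (Fin.last n))))
      (by have h := dfrTwist_twist_comp_neg ν N (-1 : k); rwa [neg_neg] at h)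
      (dfrTwist_twist_comp_neg ν N 1)
  have hf'irr : Irreducible f' := (MulEquiv.irreducible_iff eT).mpr hfirr
  have hΦinj : Function.Injective (MvPolynomial.aeval (R := k) (Fin.snoc (fun j => Polynomial.C (MvPolynomial.X j) -
      (ν.map MvPolynomial.C) ^ N j) Polynomial.X) : MvPolynomial (Fin (n + 1)) k → (MvPolynomial (Fin n) k)[X]) := by
    intro a b hab
    rw [← dfrTwist_fin_twist ν N a, ← dfrTwist_fin_twist ν N b] at hab
    exact eT.injective (((MvPolynomial.renameEquiv k finSuccEquivLast).trans
      (MvPolynomial.optionEquivLeft k (Fin n))).injective hab)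
  have hFder := dfrTwist_derivative_twist_ne_zero p ν hν0 hν' N t hNcast f hΦinj htnone htsome
  set F : (MvPolynomial (Fin n) k)[X] := MvPolynomial.aeval (Fin.snoc (fun j => Polynomial.C (MvPolynomial.X j) -
    (ν.map MvPolynomial.C) ^ N j) Polynomial.X) f with hF
  have hPf' : ((MvPolynomial.renameEquiv k finSuccEquivLast).trans (MvPolynomial.optionEquivLeft k (Fin n))) f' = F :=
    dfrTwist_fin_twist ν N f
  have hFdeg1 : 1 ≤ F.natDegree := by
    rw [hFdeg]
    exact (dfrTwist_twistedDegree_pos ν.natDegree hν1 N hN0 α₁ hα₁0).trans_le (hmax α₁ hα₁)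
  obtain ⟨c, hcu, hFc⟩ := MvPolynomial.isUnit_iff_eq_C_of_isReduced.mp hFunit
  have hc0 : c ≠ 0 := hcu.ne_zero
  have hFirr : Irreducible F := by
    rw [← hPf']
    exact (MulEquiv.irreducible_iff _).mpr hf'irr
  -- monic normalisation
  set F₁ : (MvPolynomial (Fin n) k)[X] := Polynomial.C (MvPolynomial.C c⁻¹) * F with hF₁
  have hF₁mon : F₁.Monic :=
    monic_C_mul_of_mul_leadingCoeff_eq_one (by rw [hFc, ← map_mul, inv_mul_cancel₀ hc0, map_one])
  have hCu : IsUnit (Polynomial.C (MvPolynomial.C c⁻¹ : MvPolynomial (Fin n) k)) :=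
    ((isUnit_iff_ne_zero.mpr (inv_ne_zero hc0)).map MvPolynomial.C).map Polynomial.C
  have hF₁irr : Irreducible F₁ := (irreducible_isUnit_mul hCu).mpr hFirr
  have hF₁der : derivative F₁ ≠ 0 := by
    rw [hF₁, derivative_C_mul]; exact mul_ne_zero hCu.ne_zero hFder
  -- evaluation at `(y', z)`
  have hFev : F.eval₂ (MvPolynomial.aeval (fun i => (y' i : K)) : MvPolynomial (Fin n) k →ₐ[k] K).toRingHom
      (z : K) = 0 := by
    have h1 := dfrTwist_eval₂_fin (algebraMap k K) (fun i => (y' i : K)) (z : K) f'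
    rw [hPf'] at h1
    rw [show (MvPolynomial.aeval (fun i => (y' i : K)) : MvPolynomial (Fin n) k →ₐ[k] K).toRingHom
        = MvPolynomial.eval₂Hom (algebraMap k K) (fun i => (y' i : K)) from rfl, h1]
    rwa [MvPolynomial.aeval_def] at hf'z
  have hF₁ev : F₁.eval₂ (MvPolynomial.aeval (fun i => (y' i : K)) : MvPolynomial (Fin n) k →ₐ[k] K).toRingHom
      (z : K) = 0 := by
    rw [hF₁, Polynomial.eval₂_mul, hFev, mul_zero]
  -- (C1) algebraic independence of `y'`
  have hy'ind : AlgebraicIndependent k (fun i => (y' i : K)) := by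
    rw [algebraicIndependent_iff_injective_aeval]
    refine (injective_iff_map_eq_zero _).mpr fun g hg => ?_
    by_contra hg0
    have hmem : MvPolynomial.rename Fin.castSucc g ∈ Ideal.span {f'} := by
      rw [hker', RingHom.mem_ker, MvPolynomial.aeval_rename, Fin.snoc_comp_castSucc]; exact hg
    obtain ⟨q, hq⟩ := Ideal.mem_span_singleton.mp hmem
    have hdvd : F ∣ Polynomial.C g := by
      refine ⟨((MvPolynomial.renameEquiv k finSuccEquivLast).trans (MvPolynomial.optionEquivLeft k (Fin n))) q, ?_⟩
      rw [← dfrTwist_fin_rename_castSucc g, hq, map_mul, hPf']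
    have := Polynomial.natDegree_le_of_dvd hdvd (Polynomial.C_ne_zero.mpr hg0)
    rw [Polynomial.natDegree_C] at this
    omega
  -- (C2), (C9)
  obtain ⟨hint, hsep⟩ :=
    dfrTwist_isIntegral_isSeparable (fun i => (y' i : K)) hy'ind F₁ hF₁mon hF₁irr hF₁der (z : K) hF₁ev
  -- (C5), (C6), (C3)
  have hzS : (z : K) ∈ Algebra.adjoin k (Set.range (fun i => (y' i : K)) ∪ {(z : K)}) :=
    Algebra.subset_adjoin (Set.mem_union_right _ (Set.mem_singleton _))
  have hwS : Polynomial.aeval (z : K) ν ∈ Algebra.adjoin k (Set.range (fun i => (y' i : K)) ∪ {(z : K)}) :=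
    Algebra.adjoin_mono Set.subset_union_right (Polynomial.aeval_mem_adjoin_singleton k _)
  have hyS : ∀ i, (y i : K) ∈ Algebra.adjoin k (Set.range (fun i => (y' i : K)) ∪ {(z : K)}) := fun i => by
    have : (y i : K) = (y' i : K) - (Polynomial.aeval (z : K) ν) ^ N i := by rw [hy'K]; ring
    rw [this]
    exact sub_mem (Algebra.subset_adjoin (Set.mem_union_left _ ⟨i, rfl⟩)) (pow_mem hwS _)
  have hadj' : IntermediateField.adjoin k (Set.range (fun i => (y' i : K)) ∪ {(z : K)}) = ⊤ := by
    rw [eq_top_iff, ← hadj, IntermediateField.adjoin_le_iff]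
    rintro x (⟨i, rfl⟩ | hx)
    · exact IntermediateField.algebra_adjoin_le_adjoin k _ (hyS i)
    · rw [Set.mem_singleton_iff.mp hx]
      exact IntermediateField.subset_adjoin k _ (Set.mem_union_right _ (Set.mem_singleton _))
  -- (C7) the new axis polynomial is non-zero
  have haxis' : axis n y' f' = F.map (MvPolynomial.eval₂Hom ρ (fun j => IsLocalRing.residue O (y' j))) := by
    show MvPolynomial.eval₂ (Polynomial.C.comp ρ)
      (Fin.snoc (fun j => Polynomial.C (IsLocalRing.residue O (y' j))) Polynomial.X) f' = _
    rw [dfrTwist_axis_eq_map, hPf']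
  have hax'0 : axis n y' f' ≠ 0 := by
    rw [haxis']
    have hθ : MvPolynomial.eval₂Hom ρ (fun j => IsLocalRing.residue O (y' j)) F.leadingCoeff ≠ 0 := by
      rw [hFc, MvPolynomial.eval₂Hom_C]; exact (map_ne_zero ρ).mpr hc0
    intro h
    have := Polynomial.leadingCoeff_map_of_leadingCoeff_ne_zero _ hθ
    rw [h, Polynomial.leadingCoeff_zero] at this
    exact hθ this.symm
  -- (C8) the axis order does not increase
  have hC8 : axis n y f ≠ 0 → (axis n y' f').rootMultiplicity (IsLocalRing.residue O z)
      ≤ (axis n y f).rootMultiplicity (IsLocalRing.residue O z) := by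
    intro hax
    have hQ' : axis n y' f' = MvPolynomial.eval₂ (Polynomial.C.comp ρ)
        (Fin.snoc (fun j => Polynomial.C (IsLocalRing.residue O (y j)) - (ν.map ρ) ^ N j) Polynomial.X) f := by
      show MvPolynomial.eval₂ (Polynomial.C.comp ρ)
        (Fin.snoc (fun j => Polynomial.C (IsLocalRing.residue O (y' j))) Polynomial.X) f' = _
      rw [hf', dfrTwist_eval₂_twist]
      congr 2
      funext j
      rw [hres j, map_neg, map_one, neg_one_mul, sub_eq_add_neg]
      rfl
    have hroot : (ν.map ρ).IsRoot (IsLocalRing.residue O z) := by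
      rw [Polynomial.IsRoot, Polynomial.eval_map, hρ, ← Polynomial.hom_eval₂]
      exact hw0
    have hmem : ∀ i, Fin.snoc (α := fun _ => (IsLocalRing.ResidueField O)[X])
          (fun j => Polynomial.C (IsLocalRing.residue O (y j)) - (ν.map ρ) ^ N j) Polynomial.X i
        - Fin.snoc (α := fun _ => (IsLocalRing.ResidueField O)[X])
          (fun j => Polynomial.C (IsLocalRing.residue O (y j))) Polynomial.X i
        ∈ Ideal.span {(Polynomial.X - Polynomial.C (IsLocalRing.residue O z)) ^ (s + 1)} := by
      intro i
      refine Fin.lastCases ?_ (fun j => ?_) i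
      · simp
      · simp only [Fin.snoc_castSucc, sub_sub_cancel_left]
        refine neg_mem (Ideal.mem_span_singleton.mpr ?_)
        exact (pow_dvd_pow_of_dvd (Polynomial.dvd_iff_isRoot.mpr hroot) _).trans (pow_dvd_pow _ (hNs j))
    have hdiff := dfrTwist_eval₂_sub_eval₂_mem (Polynomial.C.comp ρ) _ _ _ hmem f
    rw [← hQ'] at hdiff
    exact (dfrTwist_rootMultiplicity_le_of_dvd_sub _ _ _ hax (Ideal.mem_span_singleton.mp hdiff)).2
  exact ⟨y', z, f', hy'ind, hint, hadj', hker', hyS, hzS, hax'0, hC8, hsep⟩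

end Summit.ResolutionOfSingularities.ResolutionOfSingularities.Theorems
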